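/-
Copyright (c) 2026 the pub-hodgecm-mathlib formalisation cell (harness21).  Prover seat hodgecm-mathlib-K2E3-p12 (g5), Track B «K2-LIT» ∕ h413
(`stmt-HodgeConjecture-24833`), line `K2_E3_EllipticInputs`, unit U12-d, §L (G⁺-b)∕(K5a): THE SINGULAR SET `{disc χ_X = 0} ⊂ 𝔤𝔩₂(F)` IS HAAR-NULL, AND THE
LIMIT DENSITY OF AN EVENTUALLY CONSTANT, `|disc|^{-1∕2}`-DOMINATED SEQUENCE OF KERNELS.  2026-09-04.
-/
import Summits.HodgeConjecture.HodgeConjecture.Theorems.K2E3GL2TwistedLineWeightPairing      -- ★ p857346 (K2E5-p10 g4): `lintegral_chart_eq_smul` (chart constant)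
import Summits.HodgeConjecture.HodgeConjecture.Theorems.K2E3GL2BorelSliceLowerCell            -- ★ p857112 (K2E5-p10 g4): `discr_charpoly_fin_two_explicit`
import Summits.HodgeConjecture.HodgeConjecture.Theorems.K2E3GL2DiscrInvSqrtLocallyIntegrable  -- ★ p856597 (K2E3-p12 g3): `locallyIntegrable_sqrt_normAbs_discr_inv`
import Literature.MeasureTheory.Constructions.MvPolynomialZeroSetNull                         -- ★ `pi_zeroLocus_mvPolynomial_eq_zero`
import HarnessLib

/-!
# K2_E3 road (h413), §L — (G⁺-b)∕(K5a): the singular set of `𝔤𝔩₂(F)` is null; limit densities on the regular set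

Cell `pub/hodgecm-mathlib` (D-0151), Track B, seat K2E3-p12 (g5), §L line lead (road «U-iso-T», the orphaned K-side of K2E5-p10 (g4) re-dealt 05:22Z).
`--supports stmt-HodgeConjecture-24833 --as helper`; THEOREMS ONLY (no definition ∕ instance ∕ notation ∕ named fact ∕ `sorry`); never imports `Cruxes/…/Lines`.
Count-neutral analytic plumbing for (K5) = the assembly of the `χ̃`-twisted regular nilpotent Fourier transform «(LBGL-2b-Tw)» from the truncated twisted
`K`-averages `A_n` (★ (K1′)–(K4) of K2E5-p10 (g4)).

* §1 **`measure_setOf_discr_charpoly_eq_zero`** — `μ𝔤 {X ∈ 𝔤𝔩₂(F) | disc χ_X = 0} = 0` for every additive Haar `μ𝔤`: through the chart `y ↦ [[y₁,y₂],[y₀,y₃]]`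
  (★ `lintegral_chart_eq_smul`) the set is the zero locus of the non-zero polynomial `(Y₁ − Y₃)² + 4·Y₂·Y₀` (★ `discr_charpoly_fin_two_explicit`), null for
  the atomless product Haar measure (★ `pi_zeroLocus_mvPolynomial_eq_zero`); **`ae_isUnit_discr_charpoly`** — almost every `X` is regular semisimple.
* §2 **`exists_limitDensity_of_eventually_const`** — ABSTRACT (K5): a sequence of a.e.-strongly-measurable kernels `A_n : 𝔤𝔩₂(F) → ℂ` which is (a) eventually
  constant at every regular `X`, (b) dominated `‖A_n X‖ ≤ C·|disc χ_X|^{-1∕2}` on the regular set uniformly in `n`, (c) locally constant near every regular `X₀`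
  UNIFORMLY in `n`, has a limit density `Fr_Z` which is locally integrable (★ p856597), represents `lim_n ∫ f·A_n` for every `f ∈ C_c^∞` (dominated convergence),
  is locally constant on the regular set and satisfies `|disc|^{1∕2}·‖Fr_Z‖ ≤ max C 0` everywhere — the three (L-B) riders.

HONEST LABEL: HC_CM is proved only modulo the 7 printed citations (2 remaining named inputs: hLiu418 = stmt-HodgeConjecture-24832, h413 = stmt-HodgeConjecture-24833)
until rung 0 closes; count-neutral plumbing.

References: [HarishChandra1999AdmissibleDistributions] Harish-Chandra (DeBacker–Sally) (1999), Thm. 4.4 p. 11, §7, Lemma 7.8; [HarishChandra1970] Harish-Chandra (van Dijk),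
LNM 162 (1970), Lemma 42 (singular sets are null); [Folland1999] Folland, *Real Analysis* (1999), §2.3 Thm. 2.24 (dominated convergence), §2.5 Thm. 2.37.
-/

set_option autoImplicit false
set_option linter.dupNamespace false   -- `Summit.HodgeConjecture.HodgeConjecture.…` (D-0017 nested layout; lakefile exemption for Summits)

noncomputable section

open MeasureTheory Measure Filter Topology TopologicalSpace Set
open scoped MatrixGroups NNReal ENNReal
open Literature.NumberTheory.Rogawski1990 Literature.NumberTheory.Automorphic Literature.NumberTheory.Automorphic.LocalFieldHaar
open Literature.NumberTheory.GaloisRepresentations Literature.NumberTheory.GaloisRepresentations.IsNonarchimedeanLocalField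
open Summit.HodgeConjecture.HodgeConjecture.Cruxes.H413.K2E3NormalizedCharBddNearSemisimpleRegular (continuous_discr_charpoly)
open Summit.HodgeConjecture.HodgeConjecture.Cruxes.H413.K2E3GL2BorelSliceLowerCell (discr_charpoly_fin_two_explicit)
open Summit.HodgeConjecture.HodgeConjecture.Cruxes.H413.K2E3GL2DiscrInvSqrtLocallyIntegrable (locallyIntegrable_sqrt_normAbs_discr_inv)

namespace Summit.HodgeConjecture.HodgeConjecture.Cruxes.H413.K2E3GL2RegularSetLimitDensity

variable {F : Type*} [Field F] [ValuativeRel F] [TopologicalSpace F] [IsNonarchimedeanLocalField F]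
  [MeasurableSpace (Matrix (Fin 2) (Fin 2) F)] [BorelSpace (Matrix (Fin 2) (Fin 2) F)] (μ𝔤 : Measure (Matrix (Fin 2) (Fin 2) F)) [μ𝔤.IsAddHaarMeasure]

/-! ## §1  The singular set is null -/

omit [ValuativeRel F] [TopologicalSpace F] [IsNonarchimedeanLocalField F] [MeasurableSpace (Matrix (Fin 2) (Fin 2) F)] [BorelSpace (Matrix (Fin 2) (Fin 2) F)] in
/-- The discriminant of `𝔤𝔩₂` in the chart `y ↦ [[y₁,y₂],[y₀,y₃]]` is the evaluation of the polynomial `(Y₁ − Y₃)² + 4·Y₂·Y₀`. [folklore] -/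
theorem discr_chart_eq_eval (y : Fin 4 → F) :
    ((!![y 1, y 2; y 0, y 3] : Matrix (Fin 2) (Fin 2) F)).charpoly.discr =
      MvPolynomial.eval (fun i => y i)
        ((MvPolynomial.X 1 - MvPolynomial.X 3) ^ 2 + 4 * MvPolynomial.X 2 * MvPolynomial.X 0 : MvPolynomial (Fin 4) F) := by
  rw [discr_charpoly_fin_two_explicit]
  simp only [map_add, map_mul, map_pow, map_sub, MvPolynomial.eval_X, map_ofNat]

omit [ValuativeRel F] [TopologicalSpace F] [IsNonarchimedeanLocalField F] [MeasurableSpace (Matrix (Fin 2) (Fin 2) F)] [BorelSpace (Matrix (Fin 2) (Fin 2) F)] in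
/-- The chart polynomial `(Y₁ − Y₃)² + 4·Y₂·Y₀` is not zero (it takes the value `1` at `e₁`). [folklore] -/
theorem chartPoly_ne_zero :
    ((MvPolynomial.X 1 - MvPolynomial.X 3) ^ 2 + 4 * MvPolynomial.X 2 * MvPolynomial.X 0 : MvPolynomial (Fin 4) F) ≠ 0 := by
  intro h
  have h1 := congrArg (MvPolynomial.eval (fun i : Fin 4 => if i = 1 then (1 : F) else 0)) h
  simp only [map_add, map_mul, map_pow, map_sub, MvPolynomial.eval_X, map_ofNat, map_zero] at h1
  simp at h1

/-- **THE SINGULAR SET `{disc χ_X = 0}` OF `𝔤𝔩₂(F)` IS HAAR-NULL.**  Through the chart constant ★ `lintegral_chart_eq_smul` it is the zero locus of the non-zero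
polynomial `(Y₁ − Y₃)² + 4Y₂Y₀` in `F⁴`, null for the atomless product Haar measure ★ `pi_zeroLocus_mvPolynomial_eq_zero`.
[cite: HarishChandra1999AdmissibleDistributions, §7] -/
theorem measure_setOf_discr_charpoly_eq_zero [MeasurableSpace F] [BorelSpace F] :
    μ𝔤 {X : Matrix (Fin 2) (Fin 2) F | X.charpoly.discr = 0} = 0 := by
  haveI : T2Space F := (isLocalField F).toT2Space
  haveI : LocallyCompactSpace F := (isLocalField F).toLocallyCompactSpace
  haveI : SecondCountableTopology F := secondCountableTopology_localField F
  haveI : IsTopologicalRing F := inferInstance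
  -- an auxiliary additive Haar measure on `F`, atomless
  let dx : Measure F := Measure.addHaar
  haveI : NullSingletonClass dx := ⟨fun x => by
    have h := measure_preimage_add dx (-x) ({0} : Set F)
    have hset : (fun y : F => -x + y) ⁻¹' ({0} : Set F) = {x} := by
      ext y
      simp only [Set.mem_preimage, Set.mem_singleton_iff, neg_add_eq_zero]
      exact eq_comm
    rw [hset] at h
    rw [h, measure_singleton_zero dx]⟩
  have hS : MeasurableSet {X : Matrix (Fin 2) (Fin 2) F | X.charpoly.discr = 0} :=
    (isClosed_eq continuous_discr_charpoly continuous_const).measurableSet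
  obtain ⟨c, hc0, -, hchart⟩ := K2E3GL2TwistedLineWeightPairing.lintegral_chart_eq_smul dx μ𝔤
  have key := hchart (({X : Matrix (Fin 2) (Fin 2) F | X.charpoly.discr = 0}).indicator 1) ((measurable_const).indicator hS)
  rw [lintegral_indicator_one hS] at key
  -- the left-hand side is the product measure of the polynomial zero locus
  have hL : (fun y : Fin 4 → F => ({X : Matrix (Fin 2) (Fin 2) F | X.charpoly.discr = 0}).indicator (1 : Matrix (Fin 2) (Fin 2) F → ℝ≥0∞)
      (!![y 1, y 2; y 0, y 3] : Matrix (Fin 2) (Fin 2) F)) =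
      ({y : Fin 4 → F | MvPolynomial.eval (fun i => id (y i))
        ((MvPolynomial.X 1 - MvPolynomial.X 3) ^ 2 + 4 * MvPolynomial.X 2 * MvPolynomial.X 0 : MvPolynomial (Fin 4) F) = 0}).indicator 1 := by
    funext y
    have hiff : ((!![y 1, y 2; y 0, y 3] : Matrix (Fin 2) (Fin 2) F)) ∈ {X : Matrix (Fin 2) (Fin 2) F | X.charpoly.discr = 0} ↔
        y ∈ {y : Fin 4 → F | MvPolynomial.eval (fun i => id (y i))
          ((MvPolynomial.X 1 - MvPolynomial.X 3) ^ 2 + 4 * MvPolynomial.X 2 * MvPolynomial.X 0 : MvPolynomial (Fin 4) F) = 0} := by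
      simp only [Set.mem_setOf_eq, discr_chart_eq_eval, id]
    by_cases h : ((!![y 1, y 2; y 0, y 3] : Matrix (Fin 2) (Fin 2) F)) ∈ {X : Matrix (Fin 2) (Fin 2) F | X.charpoly.discr = 0}
    · rw [Set.indicator_of_mem h, Set.indicator_of_mem (hiff.1 h)]; rfl
    · rw [Set.indicator_of_notMem h, Set.indicator_of_notMem (fun h' => h (hiff.2 h'))]
  have hnull := Literature.MeasureTheory.Constructions.pi_zeroLocus_mvPolynomial_eq_zero (K := F) (X := F) (e := id) measurable_id
    Function.injective_id dx 4 _ (chartPoly_ne_zero (F := F))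
  have hmeas : MeasurableSet {y : Fin 4 → F | MvPolynomial.eval (fun i => id (y i))
      ((MvPolynomial.X 1 - MvPolynomial.X 3) ^ 2 + 4 * MvPolynomial.X 2 * MvPolynomial.X 0 : MvPolynomial (Fin 4) F) = 0} := by
    have hcont : Continuous fun y : Fin 4 → F => ((!![y 1, y 2; y 0, y 3] : Matrix (Fin 2) (Fin 2) F)).charpoly.discr := by
      refine continuous_discr_charpoly.comp ?_
      refine continuous_matrix fun i j => ?_
      fin_cases i <;> fin_cases j <;> simpa using continuous_apply _
    have : {y : Fin 4 → F | MvPolynomial.eval (fun i => id (y i))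
        ((MvPolynomial.X 1 - MvPolynomial.X 3) ^ 2 + 4 * MvPolynomial.X 2 * MvPolynomial.X 0 : MvPolynomial (Fin 4) F) = 0} =
        {y : Fin 4 → F | ((!![y 1, y 2; y 0, y 3] : Matrix (Fin 2) (Fin 2) F)).charpoly.discr = 0} := by
      ext y; simp only [Set.mem_setOf_eq, discr_chart_eq_eval, id]
    rw [this]
    exact (isClosed_eq hcont continuous_const).measurableSet
  rw [hL, lintegral_indicator_one hmeas, hnull] at key
  -- `0 = c * μ𝔤 S` with `c ≠ 0`
  rcases mul_eq_zero.1 key.symm with h | h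
  · exact absurd h hc0
  · exact h

/-- **Almost every `X ∈ 𝔤𝔩₂(F)` is regular semisimple** (`disc χ_X ≠ 0`). [cite: HarishChandra1999AdmissibleDistributions, §7] -/
theorem ae_isUnit_discr_charpoly [MeasurableSpace F] [BorelSpace F] :
    ∀ᵐ X ∂μ𝔤, IsUnit X.charpoly.discr := by
  rw [ae_iff]
  have : {X : Matrix (Fin 2) (Fin 2) F | ¬ IsUnit X.charpoly.discr} = {X | X.charpoly.discr = 0} := by
    ext X; simp only [Set.mem_setOf_eq, isUnit_iff_ne_zero, not_not]
  rw [this]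
  exact measure_setOf_discr_charpoly_eq_zero μ𝔤

/-! ## §2  The limit density of an eventually constant, dominated, uniformly locally constant sequence of kernels -/

/-- **ABSTRACT (K5): THE LIMIT DENSITY.**  Let `A_n : 𝔤𝔩₂(F) → ℂ` be a.e.-strongly measurable, eventually constant at every regular `X`, dominated by
`C·|disc χ_X|^{-1∕2}` on the regular set uniformly in `n`, and locally constant near every regular `X₀` uniformly in `n`.  Then there is `Fr_Z`, locally
integrable, with `∫ f·A_n → ∫ f·Fr_Z` for every `f ∈ C_c^∞(𝔤𝔩₂(F))`, locally constant on the regular set, and `|disc|^{1∕2}·‖Fr_Z‖ ≤ max C 0` everywhere.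
(`Fr_Z` = the eventual value of `A_n` on the regular set, `0` on the null singular set; ★ p856597 `|disc|^{-1∕2} ∈ L¹_loc`; dominated convergence.)
[cite: HarishChandra1999AdmissibleDistributions, Thm. 4.4 p. 11, Lemma 7.8] [cite: Folland1999, §2.3 Thm. 2.24] -/
theorem exists_limitDensity_of_eventually_const [MeasurableSpace F] [BorelSpace F] [CharZero F] {ψ : AddChar F Circle} (hψ : ψ.IsContinuousNontrivial)
    (A : ℕ → Matrix (Fin 2) (Fin 2) F → ℂ) (hAm : ∀ n, AEStronglyMeasurable (A n) μ𝔤)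
    (hev : ∀ X : Matrix (Fin 2) (Fin 2) F, IsUnit X.charpoly.discr → ∃ n₀ : ℕ, ∀ n, n₀ ≤ n → A n X = A n₀ X)
    {C : ℝ} (hbd : ∀ (n : ℕ) (X : Matrix (Fin 2) (Fin 2) F), IsUnit X.charpoly.discr →
      ‖A n X‖ ≤ C * (((NNReal.sqrt (normAbs F X.charpoly.discr))⁻¹ : ℝ≥0) : ℝ))
    (hlc : ∀ X₀ : Matrix (Fin 2) (Fin 2) F, IsUnit X₀.charpoly.discr → ∀ᶠ X in 𝓝 X₀, ∀ n, A n X = A n X₀) :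
    ∃ FrZ : Matrix (Fin 2) (Fin 2) F → ℂ, LocallyIntegrable FrZ μ𝔤 ∧
      (∀ f : Matrix (Fin 2) (Fin 2) F → ℂ, IsLocSmooth f →
        Tendsto (fun n => ∫ X, f X * A n X ∂μ𝔤) atTop (𝓝 (∫ X, f X * FrZ X ∂μ𝔤))) ∧
      (∀ X : Matrix (Fin 2) (Fin 2) F, IsUnit X.charpoly.discr → ∀ᶠ Y in 𝓝 X, FrZ Y = FrZ X) ∧
      (∀ X : Matrix (Fin 2) (Fin 2) F, ((NNReal.sqrt (normAbs F X.charpoly.discr) : ℝ≥0) : ℝ) * ‖FrZ X‖ ≤ max C 0) := by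
  classical
  haveI : T2Space F := (isLocalField F).toT2Space
  haveI : LocallyCompactSpace F := (isLocalField F).toLocallyCompactSpace
  haveI : LocallyCompactSpace (Matrix (Fin 2) (Fin 2) F) := Pi.locallyCompactSpace_of_finite
  -- the eventual index and the limit
  choose n₀ hn₀ using hev
  let FrZ : Matrix (Fin 2) (Fin 2) F → ℂ := fun X => if h : IsUnit X.charpoly.discr then A (n₀ X h) X else 0
  have hFrZ_reg : ∀ (X : Matrix (Fin 2) (Fin 2) F) (h : IsUnit X.charpoly.discr), ∀ n, n₀ X h ≤ n → A n X = FrZ X := by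
    intro X h n hn
    simp only [FrZ, dif_pos h]
    exact hn₀ X h n hn
  have hFrZ_sing : ∀ X : Matrix (Fin 2) (Fin 2) F, ¬ IsUnit X.charpoly.discr → FrZ X = 0 := fun X h => by simp only [FrZ, dif_neg h]
  -- pointwise convergence on the regular set, hence a.e.
  have htend : ∀ X : Matrix (Fin 2) (Fin 2) F, IsUnit X.charpoly.discr → Tendsto (fun n => A n X) atTop (𝓝 (FrZ X)) := by
    intro X h
    refine tendsto_const_nhds.congr' ?_
    exact (eventually_ge_atTop (n₀ X h)).mono fun n hn => (hFrZ_reg X h n hn).symm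
  have hae := ae_isUnit_discr_charpoly μ𝔤 (F := F)
  have htend_ae : ∀ᵐ X ∂μ𝔤, Tendsto (fun n => A n X) atTop (𝓝 (FrZ X)) := hae.mono fun X hX => htend X hX
  have hFrZ_m : AEStronglyMeasurable FrZ μ𝔤 := aestronglyMeasurable_of_tendsto_ae atTop hAm htend_ae
  -- the weight and the pointwise domination of the limit
  have hw := locallyIntegrable_sqrt_normAbs_discr_inv hψ μ𝔤
  have hbdFr : ∀ X : Matrix (Fin 2) (Fin 2) F, ‖FrZ X‖ ≤ C * (((NNReal.sqrt (normAbs F X.charpoly.discr))⁻¹ : ℝ≥0) : ℝ) := by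
    intro X
    by_cases h : IsUnit X.charpoly.discr
    · rw [← hFrZ_reg X h (n₀ X h) le_rfl]; exact hbd _ X h
    · rw [hFrZ_sing X h, norm_zero]
      have h0 : X.charpoly.discr = 0 := by rwa [isUnit_iff_ne_zero, not_not] at h
      rw [h0, map_zero, NNReal.sqrt_zero, inv_zero, NNReal.coe_zero, mul_zero]
  have hCw : LocallyIntegrable (fun X : Matrix (Fin 2) (Fin 2) F => C * (((NNReal.sqrt (normAbs F X.charpoly.discr))⁻¹ : ℝ≥0) : ℝ)) μ𝔤 := by
    have := hw.smul C
    simpa only [Pi.smul_def, smul_eq_mul] using this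
  refine ⟨FrZ, ?_, fun f hf => ?_, fun X hX => ?_, fun X => ?_⟩
  · -- local integrability by domination
    exact hCw.mono hFrZ_m (Eventually.of_forall fun X => (hbdFr X).trans (le_abs_self _))
  · -- dominated convergence against `f ∈ C_c^∞`
    have hfc : Continuous f := hf.continuous
    refine tendsto_integral_of_dominated_convergence (fun X => ‖f X‖ * (C * (((NNReal.sqrt (normAbs F X.charpoly.discr))⁻¹ : ℝ≥0) : ℝ)))
      (fun n => hfc.aestronglyMeasurable.mul (hAm n)) ?_ (fun n => ?_) ?_
    · have := hCw.integrable_smul_left_of_hasCompactSupport hfc.norm hf.2.norm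
      simpa only [smul_eq_mul] using this
    · exact hae.mono fun X hX => by
        rw [norm_mul]
        exact mul_le_mul_of_nonneg_left (hbd n X hX) (norm_nonneg _)
    · exact htend_ae.mono fun X hX => hX.const_mul (f X)
  · -- local constancy on the regular set
    have hopen : ∀ᶠ Y in 𝓝 X, IsUnit Y.charpoly.discr := by
      have hO : IsOpen {Y : Matrix (Fin 2) (Fin 2) F | Y.charpoly.discr ≠ 0} := isOpen_ne_fun continuous_discr_charpoly continuous_const
      exact Filter.eventually_of_mem (hO.mem_nhds (isUnit_iff_ne_zero.1 hX)) fun Y hY => isUnit_iff_ne_zero.2 hY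
    filter_upwards [hlc X hX, hopen] with Y hY hYu
    rw [← hFrZ_reg Y hYu (max (n₀ Y hYu) (n₀ X hX)) (le_max_left _ _), ← hFrZ_reg X hX (max (n₀ Y hYu) (n₀ X hX)) (le_max_right _ _)]
    exact hY _
  · -- the weighted bound
    have hD0 : 0 ≤ ((NNReal.sqrt (normAbs F X.charpoly.discr) : ℝ≥0) : ℝ) := NNReal.coe_nonneg _
    by_cases h : IsUnit X.charpoly.discr
    · have hne : (NNReal.sqrt (normAbs F X.charpoly.discr) : ℝ≥0) ≠ 0 := by
        rw [ne_eq, NNReal.sqrt_eq_zero]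
        exact (map_ne_zero (normAbs F)).2 (isUnit_iff_ne_zero.1 h)
      calc ((NNReal.sqrt (normAbs F X.charpoly.discr) : ℝ≥0) : ℝ) * ‖FrZ X‖
          ≤ ((NNReal.sqrt (normAbs F X.charpoly.discr) : ℝ≥0) : ℝ) * (C * (((NNReal.sqrt (normAbs F X.charpoly.discr))⁻¹ : ℝ≥0) : ℝ)) :=
            mul_le_mul_of_nonneg_left (hbdFr X) hD0
        _ = C := by
            rw [NNReal.coe_inv, mul_left_comm, mul_inv_cancel₀ (by exact_mod_cast hne), mul_one]
        _ ≤ max C 0 := le_max_left _ _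
    · rw [hFrZ_sing X h, norm_zero, mul_zero]; exact le_max_right _ _

end Summit.HodgeConjecture.HodgeConjecture.Cruxes.H413.K2E3GL2RegularSetLimitDensity

end
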